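import Summits.KontsevichZagierPeriods.Zeta5Search.WellPoisedFaceSandwich
import HarnessLib

/-!
# ζ(5) search — the boundary lemma for ANY number of tail bricks, I: `R_n(0)`, its Stirling rate, and the closed
form of `R″` (cell `pub-zeta5`, fam-odd gen 8, file A; census item R12 of families/odd/FAMILY.md §9)

HONEST FRAMING: systematic search; no irrationality claim unless certified.

fam-vwp's files 2–4 (`WellPoisedFaceBoundaryRate`, `…Convexity`, `…Sandwich`, this namespace) prove OUR boundary
lemma for the numerator-free face `h₁ = h₂ = h₃ = 1` of Zudilin's `r = 3`, `q = 7` box [cite: Zudilin2004, §8 (8.2),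
(8.6), (8.7)] with its FOUR tail bricks typed as `Fin 4`.  The odd-window boxes `q = 8, …, 11` (windows
`{ζ(5), ζ(7)}`, `{ζ(5), ζ(7), ζ(9)}`; fam-odd's `IntFaceDir M`, `q = M + 5`) have `B = q − 3 = M + 2` tail bricks, and
the face growth theorem of `WellPoisedFaceOddGrowth` / `WellPoisedFaceZeta579Growth` carries the lower half of the
boundary lemma as a HYPOTHESIS `hF`.  This file and its companion `WellPoisedFaceTailSandwich` discharge it: they
redo the `Fin 4` chain for `η : Fin B → ℕ`, ANY `B`, reusing every brick-count-free lemma of files 2–4 BY NAME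
(`logFactErr_bounds`, `tendsto_log_linear_div`, `tendsto_logFactErr_mul_div`, `cast_mul_log_mul`, `block`,
`block_pos`, `tendsto_log_block_div`, `lin_pos`, `pole_pos`, `hj_lt_h0`, `range_card_le`, `block_decay`,
`summable_shift_sq`, `hasSum_shift_sq`) and restating only the declarations whose TYPE mentions the brick count
(prefix `tail`).
Mathematics: verbatim the `q = 7` proofs; the one new remark is that `2h_j ≤ h₀` (not just `h_j < h₀`) makes EACH
brick's first pole term `1/(t+h_j)²` beat the whole very-well-poised term `4/(h₀+2t)²`, so log-convexity and
`(log R)′(0) ≤ −2/h₀` hold from `B ≥ 2` bricks on.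

THIS FILE (I): with `h₀ = η₀ n + 2`, `h_j = η_j n + 1` (`j : Fin B`), `2η_j < η₀`,
* `tailR0` = `R_n(0) = h₀ · ∏_j (h₀ − 2h_j)! (h_j − 1)! / (h₀ − h_j)!` VERBATIM, its block form and positivity, and
  THE RATE `tendsto_log_tailR0_div : (1/n) log R_n(0) → −Σ_j blockRate η₀ η_j` (`blockRate` of
  `WellPoisedFaceEnvelope`: `g(η₀, η) = (η₀ − η) log(η₀ − η) − (η₀ − 2η) log(η₀ − 2η) − η log η`);
* `tailR` = Zudilin's `R(t) = (h₀ + 2t) · ∏_j (h₀ − 2h_j)! / ∏_{i=0}^{h₀−2h_j} (t + h_j + i)` as a real function,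
  `tailF = ½ Σ_{t∈ℕ} R″(t)` = (8.6) on the face, the dictionary check `tailR_zero : R(0) = R_n(0)`;
* the closed form by logarithmic differentiation on `t > −1/2`: `R = exp ∘ logTailR`, `R′ = R·dlogT`,
  `R″ = iteratedDeriv 2 R = R·(dlogT² + d2logT)` (`iteratedDeriv_two_tailR`), `R > 0`;
* the two comparisons `2h_j ≤ h₀` buys: `(log R)″ > 0` on `t ≥ 0` and `(log R)′(0) ≤ −2/h₀` (`B ≥ 2`).
File B (`WellPoisedFaceTailSandwich`) adds sizes, decay, the sandwich and the rate of `F`, and the decay floor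
`exp(−(Σ_j blockRate η₀ η_j + ε)n) ≤ F_n` that `IntFaceDir.faceLambda_eventually_ge` asks for.  Standard axioms only.
-/

noncomputable section

open Real Filter Topology Finset

namespace Summit.KontsevichZagierPeriods.Zeta5Search.WellPoisedFaceRate

open Summit.KontsevichZagierPeriods.Zeta5Search.WellPoisedFace (blockRate)

variable {B : ℕ}

/-! ## T1. `R_n(0)` with `B` tail bricks and its rate -/

/-- VERBATIM `R_n(0) = h₀ · ∏_{j=4}^{q} (h₀ − 2h_j)! (h_j − 1)! / (h₀ − h_j)!` on the ray `h₀ = η₀ n + 2`,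
`h_j = η_j n + 1`, the `B = q − 3` tail bricks indexed by `Fin B` (natural subtraction honest once `2η_j < η₀`). -/
def tailR0 (η₀ : ℕ) (η : Fin B → ℕ) (n : ℕ) : ℝ :=
  ((η₀ * n + 2 : ℕ) : ℝ) * ∏ j : Fin B,
    ((((η₀ * n + 2) - 2 * (η j * n + 1)).factorial : ℕ) : ℝ) * ((((η j * n + 1) - 1).factorial : ℕ) : ℝ)
      / ((((η₀ * n + 2) - (η j * n + 1)).factorial : ℕ) : ℝ)

/-- Block form: `R_n(0) = (η₀ n + 2) · ∏_j block (η₀ − 2η_j) η_j n`. -/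
theorem tailR0_eq_blocks (η₀ : ℕ) (η : Fin B → ℕ) (hη : ∀ j, 2 * η j < η₀) (n : ℕ) :
    tailR0 η₀ η n = ((η₀ * n + 2 : ℕ) : ℝ) * ∏ j : Fin B, block (η₀ - 2 * η j) (η j) n := by
  unfold tailR0 block
  congr 1
  refine Finset.prod_congr rfl fun j _ => ?_
  have h1 : η₀ * n + 2 - 2 * (η j * n + 1) = (η₀ - 2 * η j) * n := by
    rw [Nat.sub_mul, mul_assoc]; omega
  have h2 : η j * n + 1 - 1 = η j * n := by omega
  have hle : η j * n ≤ η₀ * n := Nat.mul_le_mul_right n (by have := hη j; omega)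
  have h3 : η₀ * n + 2 - (η j * n + 1) = (η₀ - 2 * η j + η j) * n + 1 := by
    have : η₀ - 2 * η j + η j = η₀ - η j := by have := hη j; omega
    rw [this, Nat.sub_mul]; omega
  rw [h1, h2, h3]

/-- `R_n(0) > 0` on every integral face direction. -/
theorem tailR0_pos (η₀ : ℕ) (η : Fin B → ℕ) (hη : ∀ j, 2 * η j < η₀) (n : ℕ) : 0 < tailR0 η₀ η n := by
  rw [tailR0_eq_blocks η₀ η hη]
  exact mul_pos (by positivity) (Finset.prod_pos fun j _ => block_pos _ _ _)

/-- THE RATE (boundary lemma (iii)) for `B` bricks: `(1/n) log R_n(0) → −Σ_j blockRate η₀ η_j`. -/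
theorem tendsto_log_tailR0_div (η₀ : ℕ) (η : Fin B → ℕ) (hη : ∀ j, 2 * η j < η₀) :
    Tendsto (fun n : ℕ => Real.log (tailR0 η₀ η n) / n) atTop (𝓝 (-∑ j : Fin B, blockRate η₀ (η j))) := by
  have hη₀ : (0 : ℝ) ≤ η₀ := Nat.cast_nonneg η₀
  have hhead : Tendsto (fun n : ℕ => Real.log ((η₀ : ℝ) * n + 2) / n) atTop (𝓝 0) :=
    tendsto_log_linear_div hη₀ zero_le_two
  have hblocks : Tendsto (fun n : ℕ => ∑ j : Fin B, Real.log (block (η₀ - 2 * η j) (η j) n) / n) atTop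
      (𝓝 (∑ j : Fin B, ((((η₀ - 2 * η j : ℕ)) : ℝ) * Real.log (((η₀ - 2 * η j : ℕ)) : ℝ)
        + (η j : ℝ) * Real.log (η j)
        - ((((η₀ - 2 * η j : ℕ)) : ℝ) + η j) * Real.log ((((η₀ - 2 * η j : ℕ)) : ℝ) + η j)))) :=
    tendsto_finsetSum _ fun j _ => tendsto_log_block_div (η₀ - 2 * η j) (η j)
  have hsum := hhead.add hblocks
  rw [zero_add] at hsum
  have key : ∀ n : ℕ, n ≠ 0 → Real.log (tailR0 η₀ η n) / n
      = Real.log ((η₀ : ℝ) * n + 2) / n + ∑ j : Fin B, Real.log (block (η₀ - 2 * η j) (η j) n) / n := by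
    intro n hn
    rw [tailR0_eq_blocks η₀ η hη, Real.log_mul (by positivity)
      (Finset.prod_pos fun j _ => block_pos _ _ _).ne', Real.log_prod fun j _ => (block_pos _ _ _).ne',
      add_div, Finset.sum_div]
    push_cast
    ring
  have hlim : (∑ j : Fin B, ((((η₀ - 2 * η j : ℕ)) : ℝ) * Real.log (((η₀ - 2 * η j : ℕ)) : ℝ)
        + (η j : ℝ) * Real.log (η j)
        - ((((η₀ - 2 * η j : ℕ)) : ℝ) + η j) * Real.log ((((η₀ - 2 * η j : ℕ)) : ℝ) + η j)))
      = -∑ j : Fin B, blockRate (η₀ : ℝ) (η j : ℝ) := by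
    rw [← Finset.sum_neg_distrib]
    refine Finset.sum_congr rfl fun j _ => ?_
    have h2 : 2 * η j ≤ η₀ := (hη j).le
    have hc : (((η₀ - 2 * η j : ℕ)) : ℝ) = (η₀ : ℝ) - 2 * η j := by push_cast [Nat.cast_sub h2]; ring
    rw [hc, blockRate]
    have hs : (η₀ : ℝ) - 2 * η j + η j = (η₀ : ℝ) - η j := by ring
    rw [hs]
    ring
  rw [← hlim]
  refine hsum.congr' ?_
  filter_upwards [eventually_ne_atTop 0] with n hn
  exact (key n hn).symm

/-! ## T2. `R(t)` and `F = ½ Σ_t R″(t)` with `B` tail bricks -/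

/-- Zudilin's `R(t)` on the numerator-free face with `B` tail bricks, ray member `n` [(8.7) with the very-well-poised
factor `h₀ + 2t` of (8.2)]: `(h₀ + 2t) · ∏_j (h₀ − 2h_j)! / ∏_{i=0}^{h₀−2h_j} (t + h_j + i)`. -/
def tailR (η₀ : ℕ) (η : Fin B → ℕ) (n : ℕ) (t : ℝ) : ℝ :=
  (((η₀ * n + 2 : ℕ) : ℝ) + 2 * t) * ∏ j : Fin B,
    ((((η₀ * n + 2) - 2 * (η j * n + 1)).factorial : ℕ) : ℝ)
      / ∏ i ∈ Finset.range ((η₀ * n + 2) - 2 * (η j * n + 1) + 1), (t + ((η j * n + 1 : ℕ) : ℝ) + (i : ℝ))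

/-- Zudilin's form (8.6) on the face with `B` tail bricks: `F(h) = ½ Σ_{t ≥ 0} R″(t)`. -/
def tailF (η₀ : ℕ) (η : Fin B → ℕ) (n : ℕ) : ℝ :=
  (1 / 2 : ℝ) * ∑' t : ℕ, iteratedDeriv 2 (tailR η₀ η n) (t : ℝ)

/-- Dictionary check: `R(0) = R_n(0)` (the Pochhammer `(h_j)_{h₀−2h_j+1} = (h₀ − h_j)!/(h_j − 1)!`). -/
theorem tailR_zero (η₀ : ℕ) (η : Fin B → ℕ) (hη : ∀ j, 2 * η j < η₀) (n : ℕ) :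
    tailR η₀ η n 0 = tailR0 η₀ η n := by
  unfold tailR tailR0
  simp only [mul_zero, add_zero, zero_add]
  congr 1
  refine Finset.prod_congr rfl fun j _ => ?_
  have hprod : ∏ i ∈ Finset.range ((η₀ * n + 2) - 2 * (η j * n + 1) + 1), (((η j * n + 1 : ℕ) : ℝ) + (i : ℝ))
      = (((η j * n + 1).ascFactorial ((η₀ * n + 2) - 2 * (η j * n + 1) + 1) : ℕ) : ℝ) := by
    rw [Nat.ascFactorial_eq_prod_range, Nat.cast_prod]
    exact Finset.prod_congr rfl fun i _ => by norm_cast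
  have hasc : ((((η j * n + 1) - 1).factorial : ℕ) : ℝ)
      * (((η j * n + 1).ascFactorial ((η₀ * n + 2) - 2 * (η j * n + 1) + 1) : ℕ) : ℝ)
      = ((((η₀ * n + 2) - (η j * n + 1)).factorial : ℕ) : ℝ) := by
    have key := Nat.factorial_mul_ascFactorial (η j * n) ((η₀ * n + 2) - 2 * (η j * n + 1) + 1)
    have hle : 2 * (η j * n) ≤ η₀ * n := by
      have := Nat.mul_le_mul_right n (hη j).le
      rwa [mul_assoc] at this
    have h1 : η j * n + 1 - 1 = η j * n := by omega
    have h2 : η j * n + ((η₀ * n + 2) - 2 * (η j * n + 1) + 1) = (η₀ * n + 2) - (η j * n + 1) := by omega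
    rw [h1, ← h2]
    exact_mod_cast key
  have hA : (((η j * n + 1).ascFactorial ((η₀ * n + 2) - 2 * (η j * n + 1) + 1) : ℕ) : ℝ) ≠ 0 := by
    exact_mod_cast (Nat.ascFactorial_pos _ _).ne'
  rw [hprod, div_eq_div_iff hA (by positivity), ← hasc]
  ring

/-! ## T3. Closed form of `R″` by logarithmic differentiation (`t > −1/2`) -/

/-- `(log R)′(t) = 2/(h₀+2t) − Σ_j Σ_{i ≤ h₀−2h_j} 1/(t+h_j+i)`. -/
def dlogT (η₀ : ℕ) (η : Fin B → ℕ) (n : ℕ) (t : ℝ) : ℝ :=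
  2 / (((η₀ * n + 2 : ℕ) : ℝ) + 2 * t) -
    ∑ j : Fin B, ∑ i ∈ Finset.range ((η₀ * n + 2) - 2 * (η j * n + 1) + 1),
      1 / (t + ((η j * n + 1 : ℕ) : ℝ) + (i : ℝ))

/-- `(log R)″(t) = −4/(h₀+2t)² + Σ_j Σ_{i ≤ h₀−2h_j} 1/(t+h_j+i)²`. -/
def d2logT (η₀ : ℕ) (η : Fin B → ℕ) (n : ℕ) (t : ℝ) : ℝ :=
  -4 / (((η₀ * n + 2 : ℕ) : ℝ) + 2 * t) ^ 2 +
    ∑ j : Fin B, ∑ i ∈ Finset.range ((η₀ * n + 2) - 2 * (η j * n + 1) + 1),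
      1 / (t + ((η j * n + 1 : ℕ) : ℝ) + (i : ℝ)) ^ 2

/-- `log R(t)` written out (valid for `t > −1/2`). -/
def logTailR (η₀ : ℕ) (η : Fin B → ℕ) (n : ℕ) (t : ℝ) : ℝ :=
  Real.log (((η₀ * n + 2 : ℕ) : ℝ) + 2 * t) +
    ∑ j : Fin B, (Real.log ((((η₀ * n + 2) - 2 * (η j * n + 1)).factorial : ℕ) : ℝ) -
      ∑ i ∈ Finset.range ((η₀ * n + 2) - 2 * (η j * n + 1) + 1),
        Real.log (t + ((η j * n + 1 : ℕ) : ℝ) + (i : ℝ)))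

/-- every pole factor `t + h_j + i` is positive for `t > −1/2` (file 3's `pole_pos`, brick by brick). -/
theorem tail_pole_pos (η : Fin B → ℕ) (n : ℕ) {t : ℝ} (ht : -1/2 < t) (j : Fin B) (i : ℕ) :
    0 < t + ((η j * n + 1 : ℕ) : ℝ) + (i : ℝ) :=
  pole_pos (fun _ : Fin 4 => η j) n ht 0 i

/-- `R = exp ∘ logTailR` on `t > −1/2`. -/
theorem tailR_eq_exp (η₀ : ℕ) (η : Fin B → ℕ) (n : ℕ) {t : ℝ} (ht : -1/2 < t) :
    tailR η₀ η n t = Real.exp (logTailR η₀ η n t) := by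
  have hlin := lin_pos η₀ n ht
  have hpole := tail_pole_pos η n ht
  unfold tailR logTailR
  rw [Real.exp_add, Real.exp_log hlin, Real.exp_sum]
  congr 1
  refine Finset.prod_congr rfl fun j _ => ?_
  rw [Real.exp_sub, Real.exp_log (by positivity), Real.exp_sum]
  congr 1
  exact Finset.prod_congr rfl fun i _ => (Real.exp_log (hpole j i)).symm

/-- `(logTailR)′ = dlogT` on `t > −1/2`. -/
theorem hasDerivAt_logTailR (η₀ : ℕ) (η : Fin B → ℕ) (n : ℕ) {t : ℝ} (ht : -1/2 < t) :
    HasDerivAt (logTailR η₀ η n) (dlogT η₀ η n t) t := by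
  have hlin := lin_pos η₀ n ht
  have hpole := tail_pole_pos η n ht
  have h1 : HasDerivAt (fun s : ℝ => Real.log (((η₀ * n + 2 : ℕ) : ℝ) + 2 * s))
      (2 / (((η₀ * n + 2 : ℕ) : ℝ) + 2 * t)) t :=
    ((((hasDerivAt_id' (x := t)).const_mul (2 : ℝ)).const_add (((η₀ * n + 2 : ℕ) : ℝ))).log
      hlin.ne').congr_deriv (by simp)
  have h2 : ∀ j : Fin B, HasDerivAt
      (fun s : ℝ => Real.log ((((η₀ * n + 2) - 2 * (η j * n + 1)).factorial : ℕ) : ℝ) -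
        ∑ i ∈ Finset.range ((η₀ * n + 2) - 2 * (η j * n + 1) + 1),
          Real.log (s + ((η j * n + 1 : ℕ) : ℝ) + (i : ℝ)))
      (0 - ∑ i ∈ Finset.range ((η₀ * n + 2) - 2 * (η j * n + 1) + 1),
          1 / (t + ((η j * n + 1 : ℕ) : ℝ) + (i : ℝ))) t := fun j =>
    (hasDerivAt_const t _).fun_sub (HasDerivAt.fun_sum fun i _ =>
      (((hasDerivAt_id' (x := t)).add_const (((η j * n + 1 : ℕ) : ℝ))).add_const (i : ℝ)).log
        (hpole j i).ne')
  exact (h1.fun_add (HasDerivAt.fun_sum fun j _ => h2 j)).congr_deriv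
    (by simp only [dlogT, zero_sub, Finset.sum_neg_distrib]; ring)

/-- `(dlogT)′ = d2logT` on `t > −1/2`. -/
theorem hasDerivAt_dlogT (η₀ : ℕ) (η : Fin B → ℕ) (n : ℕ) {t : ℝ} (ht : -1/2 < t) :
    HasDerivAt (dlogT η₀ η n) (d2logT η₀ η n t) t := by
  have hlin := lin_pos η₀ n ht
  have hpole := tail_pole_pos η n ht
  have h1 : HasDerivAt (fun s : ℝ => 2 / (((η₀ * n + 2 : ℕ) : ℝ) + 2 * s))
      (-4 / (((η₀ * n + 2 : ℕ) : ℝ) + 2 * t) ^ 2) t :=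
    ((hasDerivAt_const t (2 : ℝ)).fun_div
      (((hasDerivAt_id' (x := t)).const_mul (2 : ℝ)).const_add (((η₀ * n + 2 : ℕ) : ℝ)))
      hlin.ne').congr_deriv (by simp only [zero_mul, mul_one, zero_sub]; ring)
  have h2 : ∀ j : Fin B, HasDerivAt
      (fun s : ℝ => ∑ i ∈ Finset.range ((η₀ * n + 2) - 2 * (η j * n + 1) + 1),
          1 / (s + ((η j * n + 1 : ℕ) : ℝ) + (i : ℝ)))
      (∑ i ∈ Finset.range ((η₀ * n + 2) - 2 * (η j * n + 1) + 1),
          (0 * (t + ((η j * n + 1 : ℕ) : ℝ) + (i : ℝ)) - 1 * 1)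
            / (t + ((η j * n + 1 : ℕ) : ℝ) + (i : ℝ)) ^ 2) t := fun j =>
    HasDerivAt.fun_sum fun i _ =>
      (hasDerivAt_const t (1 : ℝ)).fun_div
        (((hasDerivAt_id' (x := t)).add_const (((η j * n + 1 : ℕ) : ℝ))).add_const (i : ℝ))
        (hpole j i).ne'
  exact (h1.fun_sub (HasDerivAt.fun_sum fun j _ => h2 j)).congr_deriv
    (by simp only [d2logT, zero_mul, mul_one, zero_sub, neg_div, Finset.sum_neg_distrib,
          sub_neg_eq_add])

/-- `R′ = R · (log R)′` on `t > −1/2`. -/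
theorem hasDerivAt_tailR (η₀ : ℕ) (η : Fin B → ℕ) (n : ℕ) {t : ℝ} (ht : -1/2 < t) :
    HasDerivAt (tailR η₀ η n) (tailR η₀ η n t * dlogT η₀ η n t) t := by
  have hev : (fun s => Real.exp (logTailR η₀ η n s)) =ᶠ[𝓝 t] tailR η₀ η n :=
    (eventually_gt_nhds ht).mono fun s hs => (tailR_eq_exp η₀ η n hs).symm
  have h := (hasDerivAt_logTailR η₀ η n ht).exp
  rw [tailR_eq_exp η₀ η n ht]
  exact h.congr_of_eventuallyEq hev.symm

/-- `deriv R = R · dlogT` on `t > −1/2`. -/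
theorem deriv_tailR (η₀ : ℕ) (η : Fin B → ℕ) (n : ℕ) {t : ℝ} (ht : -1/2 < t) :
    deriv (tailR η₀ η n) t = tailR η₀ η n t * dlogT η₀ η n t :=
  (hasDerivAt_tailR η₀ η n ht).deriv

/-- `(R′)′ = R · ((log R)′² + (log R)″)` on `t > −1/2`. -/
theorem hasDerivAt_deriv_tailR (η₀ : ℕ) (η : Fin B → ℕ) (n : ℕ) {t : ℝ} (ht : -1/2 < t) :
    HasDerivAt (deriv (tailR η₀ η n))
      (tailR η₀ η n t * (dlogT η₀ η n t ^ 2 + d2logT η₀ η n t)) t := by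
  have hev : (fun s => tailR η₀ η n s * dlogT η₀ η n s) =ᶠ[𝓝 t] deriv (tailR η₀ η n) :=
    (eventually_gt_nhds ht).mono fun s hs => (deriv_tailR η₀ η n hs).symm
  exact (((hasDerivAt_tailR η₀ η n ht).fun_mul (hasDerivAt_dlogT η₀ η n ht)).congr_of_eventuallyEq
    hev.symm).congr_deriv (by ring)

/-- CLOSED FORM: for `t > −1/2`, `R″(t) = R(t)·((log R)′(t)² + (log R)″(t))`. -/
theorem iteratedDeriv_two_tailR (η₀ : ℕ) (η : Fin B → ℕ) (n : ℕ) {t : ℝ} (ht : -1/2 < t) :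
    iteratedDeriv 2 (tailR η₀ η n) t
      = tailR η₀ η n t * (dlogT η₀ η n t ^ 2 + d2logT η₀ η n t) := by
  rw [show (2 : ℕ) = 1 + 1 from rfl, iteratedDeriv_succ, iteratedDeriv_one]
  exact (hasDerivAt_deriv_tailR η₀ η n ht).deriv

/-- `R(t) > 0` for `t > −1/2`. -/
theorem tailR_pos (η₀ : ℕ) (η : Fin B → ℕ) (n : ℕ) {t : ℝ} (ht : -1/2 < t) : 0 < tailR η₀ η n t := by
  rw [tailR_eq_exp η₀ η n ht]; exact Real.exp_pos _

/-! ## T4. The two comparisons `2h_j ≤ h₀` buys: log-convexity and `(log R)′(0) ≤ −2/h₀` from two bricks on -/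

/-- `2h_j ≤ h₀` on an integral face direction (`2η_j < η₀`; equality only at `n = 0`). -/
theorem two_hj_le_h0 (η₀ : ℕ) (η : Fin B → ℕ) (hη : ∀ j, 2 * η j < η₀) (n : ℕ) (j : Fin B) :
    2 * ((η j * n + 1 : ℕ) : ℝ) ≤ ((η₀ * n + 2 : ℕ) : ℝ) := by
  have h2 : 2 * η j * n ≤ η₀ * n := Nat.mul_le_mul_right n (hη j).le
  exact_mod_cast (by rw [mul_assoc] at h2; omega : 2 * (η j * n + 1) ≤ η₀ * n + 2)

/-- LOG-CONVEXITY: `(log R)″(t) > 0` for `t ≥ 0` as soon as there are `B ≥ 2` bricks (each brick's first pole term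
`1/(t+h_j)²` is `≥ 4/(h₀+2t)²` because `2(t+h_j) ≤ h₀+2t`). -/
theorem d2logT_pos (hB : 2 ≤ B) (η₀ : ℕ) (η : Fin B → ℕ) (hη : ∀ j, 2 * η j < η₀) (n : ℕ) {t : ℝ}
    (ht : 0 ≤ t) : 0 < d2logT η₀ η n t := by
  have ht' : -1/2 < t := by linarith
  have hlin := lin_pos η₀ n ht'
  have hpole := tail_pole_pos η n ht'
  have hh := two_hj_le_h0 η₀ η hη n
  have key : ∀ j : Fin B, 4 / ((((η₀ * n + 2 : ℕ) : ℝ) + 2 * t)) ^ 2 ≤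
      ∑ i ∈ Finset.range ((η₀ * n + 2) - 2 * (η j * n + 1) + 1),
        1 / (t + ((η j * n + 1 : ℕ) : ℝ) + (i : ℝ)) ^ 2 := by
    intro j
    have h0mem : 0 ∈ Finset.range (((η₀ * n + 2) - 2 * (η j * n + 1)) + 1) := by simp
    have hle := Finset.single_le_sum
      (f := fun i : ℕ => 1 / (t + ((η j * n + 1 : ℕ) : ℝ) + (i : ℝ)) ^ 2)
      (fun i _ => by have := hpole j i; positivity) h0mem
    simp only [Nat.cast_zero, add_zero] at hle
    have hposj : 0 < t + ((η j * n + 1 : ℕ) : ℝ) := by simpa using hpole j 0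
    have hle2 : 2 * (t + ((η j * n + 1 : ℕ) : ℝ)) ≤ (((η₀ * n + 2 : ℕ) : ℝ) + 2 * t) := by linarith [hh j]
    have hlt : 4 / ((((η₀ * n + 2 : ℕ) : ℝ) + 2 * t)) ^ 2 ≤ 1 / (t + ((η j * n + 1 : ℕ) : ℝ)) ^ 2 := by
      rw [div_le_div_iff₀ (by positivity) (by positivity), one_mul]
      nlinarith [mul_le_mul hle2 hle2 (by positivity) hlin.le]
    exact hlt.trans hle
  have hsum := Finset.sum_le_sum fun j (_ : j ∈ (Finset.univ : Finset (Fin B))) => key j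
  simp only [Finset.sum_const, Finset.card_univ, Fintype.card_fin, nsmul_eq_mul] at hsum
  have hB' : (2 : ℝ) ≤ (B : ℝ) := by exact_mod_cast hB
  have hx : 0 < 4 / ((((η₀ * n + 2 : ℕ) : ℝ) + 2 * t)) ^ 2 := by positivity
  unfold d2logT
  have : -4 / ((((η₀ * n + 2 : ℕ) : ℝ) + 2 * t)) ^ 2 = -(4 / ((((η₀ * n + 2 : ℕ) : ℝ) + 2 * t)) ^ 2) := by
    ring
  nlinarith [mul_le_mul_of_nonneg_right hB' hx.le]

/-- `(log R)′(0) ≤ −2/h₀` as soon as there are `B ≥ 2` bricks (each brick's first pole term `1/h_j` is `≥ 2/h₀`). -/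
theorem dlogT_zero_le (hB : 2 ≤ B) (η₀ : ℕ) (η : Fin B → ℕ) (hη : ∀ j, 2 * η j < η₀) (n : ℕ) :
    dlogT η₀ η n 0 ≤ -2 / ((η₀ * n + 2 : ℕ) : ℝ) := by
  set h0 : ℝ := ((η₀ * n + 2 : ℕ) : ℝ) with hh0
  have h0pos : 0 < h0 := by rw [hh0]; positivity
  have hpole0 := tail_pole_pos η n (by norm_num : -1/2 < (0 : ℝ))
  have hh := two_hj_le_h0 η₀ η hη n
  have key : ∀ j : Fin B, 2 / h0 ≤ ∑ i ∈ Finset.range ((η₀ * n + 2) - 2 * (η j * n + 1) + 1),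
      1 / ((0 : ℝ) + ((η j * n + 1 : ℕ) : ℝ) + (i : ℝ)) := by
    intro j
    have h0mem : 0 ∈ Finset.range (((η₀ * n + 2) - 2 * (η j * n + 1)) + 1) := by simp
    have hle := Finset.single_le_sum
      (f := fun i : ℕ => 1 / ((0 : ℝ) + ((η j * n + 1 : ℕ) : ℝ) + (i : ℝ)))
      (fun i _ => (one_div_pos.mpr (hpole0 j i)).le) h0mem
    simp only [Nat.cast_zero, add_zero, zero_add] at hle
    have hjpos : (0 : ℝ) < ((η j * n + 1 : ℕ) : ℝ) := by positivity
    have : 2 / h0 ≤ 1 / ((η j * n + 1 : ℕ) : ℝ) := by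
      rw [div_le_div_iff₀ h0pos hjpos, one_mul]; exact hh j
    refine this.trans (hle.trans (le_of_eq ?_))
    refine Finset.sum_congr rfl fun i _ => by rw [zero_add]
  have hsum := Finset.sum_le_sum fun j (_ : j ∈ (Finset.univ : Finset (Fin B))) => key j
  simp only [Finset.sum_const, Finset.card_univ, Fintype.card_fin, nsmul_eq_mul] at hsum
  have hB' : (2 : ℝ) ≤ (B : ℝ) := by exact_mod_cast hB
  have hx : 0 < 2 / h0 := by positivity
  unfold dlogT
  rw [mul_zero, add_zero]
  have : -2 / h0 = -(2 / h0) := by ring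
  nlinarith [mul_le_mul_of_nonneg_right hB' hx.le]

end Summit.KontsevichZagierPeriods.Zeta5Search.WellPoisedFaceRate

end
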